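import Summits.NavierStokesRegularity.NavierStokesRegularity.Theses.QuantisedSymmetry
import Summits.NavierStokesRegularity.NavierStokesRegularity.Theorems.QuantisedSymmetryPolyhedralDssProfileExistsCellOfProfile
import HarnessLib

/-!
# Strategist s3 sketch — crux `PolyhedralDssProfileExists` (stmt-NavierStokesRegularity-1404)

Typed versions of the best decomposition (D2: computer-assisted Newton–Kantorovich split) and of the
strengthening S⁺ considered in `STRATEGY-CENSUS-s3.md`, with the two kernel-checked facts the census
relies on:

* `crux_of_nk` : `AbstractQuadraticNK → PolyhedralNKCertificate → PolyhedralDssProfileExists`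
  (the assembly of the split is real and short);
* `nkCertificate_of_crux` : `PolyhedralDssProfileExists → PolyhedralNKCertificate`
  (the ∃-over-models certificate piece is implied back by the crux through a ONE-DIMENSIONAL toy model,
  so as long as the Banach model is existentially quantified the split has exactly one open piece and that
  piece is the crux: criterion (c) "no piece gives X on its own" fails).

Nothing here is proposed to the tree; it is evidence for the census only.
-/

set_option linter.dupNamespace false
set_option linter.unusedVariables false

namespace Summit.NavierStokesRegularity.NavierStokesRegularity.Cruxes.PolyhedralDssProfileExists.StrategistS3

open MeasureTheory Set Function Filter Topology
open Literature.Analysis.FluidPDE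
open _root_.Summit.NavierStokesRegularity.NavierStokesRegularity.Theses.QuantisedSymmetry
  (PolyhedralDssProfileExists)

abbrev E3 := EuclideanSpace ℝ (Fin 3)

/-- The admissible symmetry groups of the crux: finite, proper rotations, irreducible on `ℝ³`
(i.e. conjugate to `T`, `O` or `I`). -/
def IsPolyhedralGroup (G : Subgroup (E3 ≃ₗᵢ[ℝ] E3)) : Prop :=
  Finite G ∧ (∀ g ∈ G, LinearMap.det (g.toLinearEquiv : E3 →ₗ[ℝ] E3) = 1) ∧
    ∀ V : Submodule ℝ E3, (∀ g ∈ G, ∀ v ∈ V, g v ∈ V) → V = ⊥ ∨ V = ⊤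

/-- A polyhedral cell with factor `c` (the body of the registered stub `stub_polyhedralCellExists`,
with `G`, `c`, `v` as parameters). -/
def IsPolyhedralCell (G : Subgroup (E3 ≃ₗᵢ[ℝ] E3)) (c : ℝ) (v : ℝ → E3 → E3) : Prop :=
  (ContinuousOn (Function.uncurry v) (Set.Icc (-1 : ℝ) (-(c ^ 2)⁻¹) ×ˢ Set.univ) ∧
      (∃ M : ℝ, ∀ t ∈ Set.Icc (-1 : ℝ) (-(c ^ 2)⁻¹), ∀ x, ‖v t x‖ ≤ M) ∧
      (∀ t ∈ Set.Icc (-1 : ℝ) (-(c ^ 2)⁻¹), IsWeaklyDivFree (v t)) ∧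
      (∀ s t : ℝ, -1 ≤ s → s < t → t ≤ -(c ^ 2)⁻¹ → ∀ x,
        v t x = heatFlow (v s) (t - s) x - oseenDuhamel 1 s v v t x) ∧
      (∀ x, v (-(c ^ 2)⁻¹) x = c • v (-1) (c • x)) ∧
      (∀ g ∈ G, ∀ t ∈ Set.Icc (-1 : ℝ) (-(c ^ 2)⁻¹), ∀ x, v t (g x) = g (v t x))) ∧
    MemLp (v (-1)) 4 volume ∧ ¬ (v (-1) =ᵐ[volume] 0)

/-- `PolyhedralCellExists` with the vocabulary above (definitionally the RHS of
`polyhedralDssProfileExists_iff_cell`). -/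
def PolyhedralCellExists' : Prop :=
  ∃ G : Subgroup (E3 ≃ₗᵢ[ℝ] E3), IsPolyhedralGroup G ∧ ∃ c : ℝ, 1 < c ∧ ∃ v, IsPolyhedralCell G c v

theorem polyhedralCellExists'_iff : PolyhedralCellExists' ↔ PolyhedralDssProfileExists := by
  rw [Theorems.PolyhedralDssProfileExists.PolyhedralCell.polyhedralDssProfileExists_iff_cell]
  constructor
  · rintro ⟨G, ⟨hfin, hdet, hirr⟩, c, hc, v, hv⟩
    exact ⟨G, hfin, hdet, hirr, c, hc, v, hv⟩
  · rintro ⟨G, hfin, hdet, hirr, c, hc, v, hv⟩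
    exact ⟨G, ⟨hfin, hdet, hirr⟩, c, hc, v, hv⟩

/-! ## D2 — the computer-assisted (Newton–Kantorovich / radii-polynomial) split -/

/-- The NK inequalities for the quadratic fixed-point problem `x = B x x` at the reference point `x₀`
with approximate inverse `A`, residual bound `Y`, contraction bound `Z` on the closed ball of radius `r`:
the Newton-like map `T x = x - A (x - B x x)` has `‖T x₀ - x₀‖ ≤ Y`, `‖DT‖ ≤ Z < 1` on the ball,
maps the ball into itself (`Y + Z r ≤ r`), `A` is injective (so fixed points of `T` solve `x = B x x`),
and `r < ‖x₀‖` (so the solution found is not `0`). -/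
def NKInequalities (E : Type) [NormedAddCommGroup E] [NormedSpace ℝ E]
    (B : E →L[ℝ] E →L[ℝ] E) (x₀ : E) (A : E →L[ℝ] E) (Y Z r : ℝ) : Prop :=
  0 < r ∧ r < ‖x₀‖ ∧ Function.Injective A ∧
    ‖A (x₀ - B x₀ x₀)‖ ≤ Y ∧
    ‖ContinuousLinearMap.id ℝ E - A.comp (ContinuousLinearMap.id ℝ E - (B x₀ + B.flip x₀))‖
        + 2 * ‖A‖ * ‖B‖ * r ≤ Z ∧
    Z < 1 ∧ Y + Z * r ≤ r

/-- **Piece A (a theorem of functional analysis; provable from Mathlib's contraction mapping principle):**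
the abstract radii-polynomial / Newton–Kantorovich theorem for quadratic maps on Banach spaces. -/
def AbstractQuadraticNK : Prop :=
  ∀ (E : Type) [NormedAddCommGroup E] [NormedSpace ℝ E] [CompleteSpace E]
    (B : E →L[ℝ] E →L[ℝ] E) (x₀ : E) (A : E →L[ℝ] E) (Y Z r : ℝ),
    NKInequalities E B x₀ A Y Z r → ∃ x : E, ‖x - x₀‖ ≤ r ∧ x ≠ 0 ∧ x = B x x

/-- **Piece B (the certificate, Banach model existentially quantified):** some Banach model `(E, B, ι)` of
the polyhedral cell problem — every nonzero solution of `x = B x x` realises, through `ι`, a polyhedral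
cell for a fixed admissible `(G, c)` — admits reference data `(x₀, A, Y, Z, r)` satisfying the NK
inequalities. In the intended reading `E = Y_G` (equivariant `s`-periodic weighted Leray profiles),
`B = -𝔅` (the ancient Oseen–Duhamel bilinear form of stub N21 `ancientDuhamel`), `x₀` a Galerkin ×
Fourier polynomial found by EVENMAP-PROTOCOL, `A` a floating-point approximate inverse with interval bounds. -/
def PolyhedralNKCertificate : Prop :=
  ∃ (E : Type) (_ : NormedAddCommGroup E) (_ : NormedSpace ℝ E) (_ : CompleteSpace E)
    (B : E →L[ℝ] E →L[ℝ] E) (ι : E → ℝ → E3 → E3) (G : Subgroup (E3 ≃ₗᵢ[ℝ] E3)) (c : ℝ),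
    IsPolyhedralGroup G ∧ 1 < c ∧
    (∀ x : E, x = B x x → x ≠ 0 → IsPolyhedralCell G c (ι x)) ∧
    ∃ (x₀ : E) (A : E →L[ℝ] E) (Y Z r : ℝ), NKInequalities E B x₀ A Y Z r

/-- **Assembly of D2 (kernel-checked):** piece A and piece B give the crux. -/
theorem crux_of_nk (hA : AbstractQuadraticNK) (hB : PolyhedralNKCertificate) :
    PolyhedralDssProfileExists := by
  obtain ⟨E, _, _, _, B, ι, G, c, hG, hc, hsound, x₀, A, Y, Z, r, hNK⟩ := hB
  obtain ⟨x, -, hx0, hfix⟩ := hA E B x₀ A Y Z r hNK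
  exact polyhedralCellExists'_iff.mp ⟨G, hG, c, hc, ι x, hsound x hfix hx0⟩

/-- **Collapse of D2 (kernel-checked):** with the Banach model existentially quantified, the certificate piece
is implied by the crux itself through the toy model `E = ℝ`, `B a b = a b`, `x₀ = 1`, `A = -id`,
`(Y, Z, r) = (0, 1/2, 1/4)`, `ι ≡` the true cell. Hence piece B ⟺ crux (given the theorem A): the split has
one open piece and it is the crux. A non-collapsing version must FIX the model `(Y_G, 𝔅, ι)` — and then piece B
becomes "some solution of the fixed model is NK-certifiable", i.e. the strengthening `S⁺` below. -/
theorem nkCertificate_of_crux (h : PolyhedralDssProfileExists) : PolyhedralNKCertificate := by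
  obtain ⟨G, hG, c, hc, v, hv⟩ := polyhedralCellExists'_iff.mpr h
  refine ⟨ℝ, inferInstance, inferInstance, inferInstance, ContinuousLinearMap.mul ℝ ℝ, fun _ => v, G, c,
    hG, hc, fun _ _ _ => hv, 1, -ContinuousLinearMap.id ℝ ℝ, 0, 1 / 2, 1 / 4, ?_⟩
  refine ⟨by norm_num, by norm_num, ?_, ?_, ?_, by norm_num, by norm_num⟩
  · intro a b hab
    simpa using hab
  · simp
  · -- `‖id - (-id) ∘ (id - (mul 1 + mul.flip 1))‖ + 2‖-id‖‖mul‖·(1/4) ≤ 1/2`: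
    -- `mul 1 + mul.flip 1 = 2 • id`, so the first operator is `id + (id - 2 id) = 0`.
    have hop : ContinuousLinearMap.id ℝ ℝ -
        (-ContinuousLinearMap.id ℝ ℝ).comp (ContinuousLinearMap.id ℝ ℝ -
          (ContinuousLinearMap.mul ℝ ℝ 1 + (ContinuousLinearMap.mul ℝ ℝ).flip 1)) = 0 := by
      ext
      simp
    have hA : ‖-ContinuousLinearMap.id ℝ ℝ‖ ≤ 1 := by
      rw [norm_neg]; exact ContinuousLinearMap.norm_id_le
    have hBn : ‖ContinuousLinearMap.mul ℝ ℝ‖ ≤ 1 := ContinuousLinearMap.opNorm_mul_le ℝ ℝ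
    rw [hop, norm_zero, zero_add]
    have h0A : (0 : ℝ) ≤ ‖-ContinuousLinearMap.id ℝ ℝ‖ := norm_nonneg (-ContinuousLinearMap.id ℝ ℝ)
    have h0B : (0 : ℝ) ≤ ‖ContinuousLinearMap.mul ℝ ℝ‖ := norm_nonneg (ContinuousLinearMap.mul ℝ ℝ)
    nlinarith [mul_le_mul hA hBn h0B zero_le_one]

/-! ## S⁺ — the strengthening "a NONDEGENERATE (NK-certifiable) polyhedral cell exists" -/

/-- **S⁺ (typed):** for the FIXED intended model — any Banach space `E` with a bounded bilinear `B` and a sound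
realisation map — there is a solution `x⋆ ≠ 0` of `x = B x x` at which `id - (B x⋆ + B.flip x⋆)` is
invertible (hyperbolicity / nondegeneracy of the relative periodic orbit modulo the symmetries already
quotiented into `E`). Stated over an abstract fixed model `𝓜` so that it is a property of the model, not an
`∃` over models. `S⁺ 𝓜 → crux` is immediate from soundness; the census explains why the added rigidity
(local uniqueness, persistence, NK-certifiability) gives no leverage on EXISTENCE. -/
structure CellModel where
  E : Type
  [inst₁ : NormedAddCommGroup E]
  [inst₂ : NormedSpace ℝ E]
  [inst₃ : CompleteSpace E]
  B : E →L[ℝ] E →L[ℝ] E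
  ι : E → ℝ → E3 → E3
  G : Subgroup (E3 ≃ₗᵢ[ℝ] E3)
  c : ℝ
  hG : IsPolyhedralGroup G
  hc : 1 < c
  sound : ∀ x : E, x = B x x → x ≠ 0 → IsPolyhedralCell G c (ι x)

attribute [instance] CellModel.inst₁ CellModel.inst₂ CellModel.inst₃

/-- `S⁺ 𝓜`: the fixed model has a nondegenerate nonzero solution. -/
def NondegenerateCellExists (𝓜 : CellModel) : Prop :=
  ∃ x : 𝓜.E, x ≠ 0 ∧ x = 𝓜.B x x ∧
    (ContinuousLinearMap.id ℝ 𝓜.E - (𝓜.B x + 𝓜.B.flip x)).IsInvertible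

theorem crux_of_nondegenerateCell (𝓜 : CellModel) (h : NondegenerateCellExists 𝓜) :
    PolyhedralDssProfileExists := by
  obtain ⟨x, hx0, hfix, -⟩ := h
  exact polyhedralCellExists'_iff.mp ⟨𝓜.G, 𝓜.hG, 𝓜.c, 𝓜.hc, 𝓜.ι x, 𝓜.sound x hfix hx0⟩

/-! ## Y1 — the strictly weaker intermediate read off the summit (route level, not a line) -/

/-- The sector-free statement the summit actually needs from this route: a Type-I DSS ancient mild profile
with ANY symmetry (= `Blowup.BlowupTypeIDssProfile`, stmt-0155, up to the tree's bridge). The crux implies it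
(`stub_dominatesBlowupProfile`, p156644) and it already implies `¬ NavierStokesRegularity` through the landed
sector-agnostic `dssTruncationBridge_proof` (stmt-14477) — so it can replace the crux in `closes`, but it is not
a line for THIS crux (it does not give the polyhedral `G` back). -/
def SectorFreeTypeIDssProfileExists : Prop :=
  ∃ c : ℝ, 1 < c ∧ ∃ u : ℝ → E3 → E3,
    IsAncientMildSolution 1 u ∧ (∀ t < 0, AEStronglyMeasurable (u t) volume) ∧
    IsDiscretelySelfSimilar c u ∧ (∃ C₀ : ℝ, HasTypeIDecay C₀ u) ∧ ¬ (∀ t < 0, u t =ᵐ[volume] 0)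

theorem sectorFree_of_crux (h : PolyhedralDssProfileExists) : SectorFreeTypeIDssProfileExists := by
  obtain ⟨G, -, -, -, c, hc, u, hmild, hmeas, hdss, hdec, -, hnt⟩ := h
  exact ⟨c, hc, u, hmild, hmeas, hdss, hdec, hnt⟩

end Summit.NavierStokesRegularity.NavierStokesRegularity.Cruxes.PolyhedralDssProfileExists.StrategistS3
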